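import Summits.CriticalPhenomena.SAWScalingLimit.Theorems.SAWDevelopingMapObservableToSLERestrictionCocycleHelpersPackage
import HarnessLib

/-!
# Crux `HexConjecture` (stmt-CriticalPhenomena-0808), line `root-locality-replaces-loewner`,
stub `stub_avoidanceCocycle`, step (b): the conformal package at the ROOT

Landing target:
`Summits/CriticalPhenomena/SAWScalingLimit/Theorems/SAWDevelopingMapHexConjectureAvoidanceCocyclePackage.lean`
(`--supports stmt-CriticalPhenomena-0808`).

For a Dobrushin domain `(D; a, b)` flat (horizontal upper half-discs of radius `ρ`) at both marked
points, a hull subdomain `D'`, a chordal uniformizing map `φ` of `D` and the restriction map `Φ_A`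
of the pulled-back hull `A` with `Φ_A'(0) = d`, `exists_conformalPackageRoot` produces the
conformal data consumed by the two instances of Duminil-Copin–Smirnov's Conjecture 2
(`HexObservableLimitR`, in `(D, Λ)` and in `(D', Λ')`) of the ratio computation of
`stub_avoidanceCocycle`: the half-plane maps `Ψ = -1/φ⁻¹ : D → ℍ`, `Ψ' = -1/(Φ_A ∘ φ⁻¹) : D' → ℍ`
(`a ↦ ∞`, `b ↦ 0`), continuous logarithms `L, L'` of their derivatives with boundary limits
`Lb, L'b` at `b`, flatness of `D'` at `a, b` with a radius `ρ₁ ≤ ρ` (all as in the floor line's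
`exists_conformalPackage` of crux stmt-CriticalPhenomena-10472), together with the ROOT datum of
this line: the bulk ratio of the two limit kernels

  `q(z) = exp ((5/8)((L'(z) - L'b) - (L(z) - Lb)))`

CONVERGES as `z → a` inside `D'`, to a number `q₀` with `|q₀| = d^{-5/8}`
(`exp (L' - L) = N ∘ φ⁻¹`, `N = E' w²/E²` for the Schwarz reflection `E` of `Φ_A`, `N → 1/d` at
`0` and `N → 1 = exp (L'b - Lb)` at `∞`, sibling `…RestrictionCocycleHelpersCoalescence`; the
lift from `exp` to the logarithm uses the local connectedness of the flat half-disc at `a`,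
`tendsto_log_of_tendsto_exp_of_flat`).  The phase of `q₀` is irrelevant for the modulus
computation of the line.
-/

noncomputable section

open scoped Topology Real
open Filter Set Metric Complex Bornology
open Literature.Probability.RandomPlanarGeometry
open UpperHalfPlane (upperHalfPlaneSet isOpen_upperHalfPlaneSet)
open Summit.CriticalPhenomena.SAWScalingLimit.Theorems.ObservableToSLE.FloorRatio
  (flat_of_subset mem_frontier_of_flat exists_halfPlaneMap exists_log_deriv
    exists_tendsto_log_deriv_of_flat deriv_halfPlaneMap_pullback exp_sub_eq_of_tendsto
    tendsto_derivRatio_cocompact tendsto_derivRatio_zero)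

namespace Summit.CriticalPhenomena.SAWScalingLimit.Theorems.HexConjecture.RootLocality.Cocycle

/-! ### Lifting a limit of `exp M` to a limit of `M` at a flat boundary point -/

/-- **A continuous logarithm with convergent exponential converges, at a flat boundary point.**
If `S ∩ B(x, r)` is the upper half-disc, `M` is continuous on `S` and `exp M → ν ≠ 0` at `x`
within `S`, then `M → M₀` within `S` for some `M₀` with `exp M₀ = ν`: on a small half-disc
(convex, hence connected) `M - log (exp M / ν)` is continuous with values in `log ν + 2πiℤ`, hence
constant. [folklore] -/
theorem tendsto_log_of_tendsto_exp_of_flat {S : Set ℂ} {x : ℂ} {r : ℝ} (hr : 0 < r)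
    (hflat : S ∩ ball x r = {z : ℂ | x.im < z.im} ∩ ball x r) {M : ℂ → ℂ}
    (hM : ContinuousOn M S) {ν : ℂ} (hν : ν ≠ 0)
    (hlim : Tendsto (fun z => exp (M z)) (𝓝[S] x) (𝓝 ν)) :
    ∃ M₀ : ℂ, exp M₀ = ν ∧ Tendsto M (𝓝[S] x) (𝓝 M₀) := by
  -- `exp (M z) / ν → 1`, so it lies in `B(1, 1/2)` on a small half-disc `T = S ∩ B(x, r')`
  have hlim1 : Tendsto (fun z => exp (M z) / ν) (𝓝[S] x) (𝓝 1) := by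
    simpa [div_self hν] using hlim.div_const ν
  have hev : ∀ᶠ z in 𝓝[S] x, exp (M z) / ν ∈ ball (1 : ℂ) (1 / 2) :=
    hlim1 (ball_mem_nhds _ (by norm_num))
  rw [eventually_nhdsWithin_iff, Metric.eventually_nhds_iff_ball] at hev
  obtain ⟨r₀, hr₀, hr₀b⟩ := hev
  set r' : ℝ := min r r₀ with hr'
  have hr'pos : 0 < r' := lt_min hr hr₀
  set T : Set ℂ := S ∩ ball x r' with hT
  have hTflat : T = {z : ℂ | x.im < z.im} ∩ ball x r' :=
    flat_of_subset hflat (ball_subset_ball (min_le_left _ _)) rfl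
  have hTconv : Convex ℝ T := by
    rw [hTflat]; exact (convex_halfSpace_im_gt _).inter (convex_ball _ _)
  have hTball : ∀ z ∈ T, exp (M z) / ν ∈ ball (1 : ℂ) (1 / 2) := fun z hz =>
    hr₀b z (ball_subset_ball (min_le_right _ _) hz.2) hz.1
  have hslit : ∀ z ∈ T, exp (M z) / ν ∈ slitPlane := by
    intro z hz
    have h := hTball z hz
    rw [mem_ball, dist_eq_norm] at h
    refine Or.inl ?_
    have h1 := abs_re_le_norm (exp (M z) / ν - 1)
    rw [sub_re, one_re] at h1
    have := (abs_lt.1 (h1.trans_lt h)).1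
    linarith
  -- the function `k = M - log (exp M / ν)` is continuous on `T` with `exp k = ν`
  set k : ℂ → ℂ := fun z => M z - log (exp (M z) / ν) with hk
  have hkexp : ∀ z ∈ T, exp (k z) = ν := by
    intro z hz
    have hne : exp (M z) / ν ≠ 0 := div_ne_zero (exp_ne_zero _) hν
    rw [hk]
    simp only
    rw [exp_sub, exp_log hne]
    field_simp
  have hkc : ContinuousOn k T := by
    refine (hM.mono inter_subset_left).sub ?_
    exact (((continuous_exp.comp_continuousOn (hM.mono inter_subset_left))).div_const ν).clog hslit
  -- `T` is nonempty: `z₀ = x + i r'/2`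
  set z₀ : ℂ := x + I * ((r' / 2 : ℝ) : ℂ) with hz₀
  have hz₀T : z₀ ∈ T := by
    rw [hTflat]
    refine ⟨?_, ?_⟩
    · show x.im < z₀.im
      simp [hz₀, hr'pos]
    · rw [mem_ball, dist_eq_norm, hz₀, add_sub_cancel_left, norm_mul, norm_I, one_mul, norm_real,
        Real.norm_of_nonneg (by positivity)]
      linarith
  -- `k` is constant on the connected `T`
  have hconst : ∀ z ∈ T, k z = k z₀ := by
    intro z hz
    refine hTconv.isPreconnected.constant_of_mapsTo
      (T := ((fun c => c + k z₀) '' ((AddSubgroup.zmultiples (2 * π * I) : AddSubgroup ℂ) : Set ℂ)))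
      ?_ hkc ?_ hz hz₀T
    · refine (SetLike.isDiscrete_iff_discreteTopology.2
        (inferInstance : DiscreteTopology (AddSubgroup.zmultiples (2 * π * I)))).image_of_isOpenMap
        ?_ ?_
      · exact (isOpenMap_add_right (k z₀))
      · exact (add_left_injective (k z₀))
    · intro w hw
      have h1 : exp (k w - k z₀) = 1 := by rw [exp_sub, hkexp w hw, hkexp z₀ hz₀T, div_self hν]
      obtain ⟨n, hn⟩ := Complex.exp_eq_one_iff.1 h1
      refine ⟨k w - k z₀, ⟨n, by simp [zsmul_eq_mul, hn]⟩, by ring⟩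
  refine ⟨k z₀, hkexp z₀ hz₀T, ?_⟩
  -- `M z = log (exp (M z) / ν) + k z₀ → log 1 + k z₀`
  have hlog : Tendsto (fun z => log (exp (M z) / ν)) (𝓝[S] x) (𝓝 0) := by
    have h := ((continuousAt_clog (Or.inl (by norm_num : (0 : ℝ) < (1 : ℂ).re))).tendsto).comp hlim1
    rwa [Function.comp_def, Complex.log_one] at h
  have hTmem : ∀ᶠ z in 𝓝[S] x, z ∈ T := by
    filter_upwards [self_mem_nhdsWithin, mem_nhdsWithin_of_mem_nhds (ball_mem_nhds x hr'pos)]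
      with z hzS hzb
    exact ⟨hzS, hzb⟩
  refine ((hlog.add_const (k z₀)).congr' ?_).trans (by rw [zero_add])
  filter_upwards [hTmem] with z hz
  have h := hconst z hz
  rw [hk] at h
  simp only at h
  linear_combination -h

/-! ### The conformal package at the root -/

/-- **The conformal package of the ratio computation, with the root datum.**  See the module
docstring: half-plane maps `Ψ = -1/φ⁻¹ : D → ℍ`, `Ψ' : D' → ℍ` with `a ↦ ∞`, `b ↦ 0`, continuous
logarithms `L, L'` of `Ψ', Ψ''` with boundary limits `Lb, L'b` at `b`, flatness of `D'` at `a, b`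
with radius `ρ₁ ≤ ρ`, and the convergence at the root `a` of the bulk ratio
`exp ((5/8)((L' - L'b) - (L - Lb))) → q₀` inside `D'`, `|q₀| · d^{5/8} = 1`.
[cite: LawlerSchrammWerner2003Restriction, §2 (2.4) p. 7 and §2 p. 9, transposed] -/
theorem exists_conformalPackageRoot (D D' : DobrushinDomain) (ρ : ℝ)
    (φ : ConformalEquiv upperHalfPlaneSet D.carrier)
    (Φ : ConformalEquiv (upperHalfPlaneSet \ φ.pullbackHull D') upperHalfPlaneSet) (d : ℝ)
    (hρ : 0 < ρ)
    (hflat0 : D.carrier ∩ ball (D.pt 0) ρ = {z : ℂ | (D.pt 0).im < z.im} ∩ ball (D.pt 0) ρ)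
    (hflat1 : D.carrier ∩ ball (D.pt 1) ρ = {z : ℂ | (D.pt 1).im < z.im} ∩ ball (D.pt 1) ρ)
    (hD' : D.IsHullSubdomain D') (hφ : D.IsChordalUniformizing φ)
    (hΦ : IsRestrictionMap (φ.pullbackHull D') Φ)
    (hd : HasRestrictionDeriv (φ.pullbackHull D') Φ d) :
    ∃ (Ψ : ConformalEquiv D.carrier upperHalfPlaneSet) (L : ℂ → ℂ) (Lb : ℂ)
      (Ψ' : ConformalEquiv D'.carrier upperHalfPlaneSet) (L' : ℂ → ℂ) (L'b : ℂ) (ρ₁ : ℝ) (q₀ : ℂ),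
      0 < ρ₁ ∧ ρ₁ ≤ ρ ∧ 0 < d ∧ (∀ z, Ψ z = -(φ.symm z)⁻¹) ∧
      Tendsto (fun z => ‖Ψ z‖) (𝓝[D.carrier] (D.pt 0)) atTop ∧ Ψ.HasBoundaryValue (D.pt 1) 0 ∧
      ContinuousOn L D.carrier ∧ (∀ z ∈ D.carrier, exp (L z) = deriv Ψ z) ∧
      Tendsto L (𝓝[D.carrier] (D.pt 1)) (𝓝 Lb) ∧
      Tendsto (fun z => ‖Ψ' z‖) (𝓝[D'.carrier] (D.pt 0)) atTop ∧ Ψ'.HasBoundaryValue (D.pt 1) 0 ∧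
      ContinuousOn L' D'.carrier ∧ (∀ z ∈ D'.carrier, exp (L' z) = deriv Ψ' z) ∧
      Tendsto L' (𝓝[D'.carrier] (D.pt 1)) (𝓝 L'b) ∧
      D'.carrier ∩ ball (D.pt 0) ρ₁ = {z : ℂ | (D.pt 0).im < z.im} ∩ ball (D.pt 0) ρ₁ ∧
      D'.carrier ∩ ball (D.pt 1) ρ₁ = {z : ℂ | (D.pt 1).im < z.im} ∩ ball (D.pt 1) ρ₁ ∧
      ‖q₀‖ * d ^ ((5 : ℝ) / 8) = 1 ∧
      Tendsto (fun z => exp ((5 / 8 : ℂ) * ((L' z - L'b) - (L z - Lb)))) (𝓝[D'.carrier] (D.pt 0))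
        (𝓝 q₀) := by
  -- names
  set a₀ : ℂ := D.pt 0 with ha₀
  set b₀ : ℂ := D.pt 1 with hb₀
  have hab : a₀ ≠ b₀ := fun h => absurd (D.pt_injective h) (by decide)
  have hdab : 0 < dist a₀ b₀ := dist_pos.2 hab
  have hsub : D'.carrier ⊆ D.carrier := hD'.carrier_subset
  -- the hull and its reflected restriction map
  have hA : IsStarHull (φ.pullbackHull D') :=
    IsStarHull.pullbackHull JordanDomain.isSimplyConnected_holds hφ hD'
  have hB : IsBoundedHull (φ.pullbackHull D') := hA.isBoundedHull
  have hd0 : 0 < d := by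
    obtain ⟨d', hd'0, -, hd'⟩ := IsStarHull.exists_hasRestrictionDeriv_holds hA hΦ
    rwa [HasRestrictionDeriv.unique hA hd hd']
  -- the half-plane maps and the logarithms
  obtain ⟨Ψ, hΨ, hΨinf, hΨb, hΨreal⟩ := exists_halfPlaneMap D φ hφ
  obtain ⟨L, hLc, hLe⟩ := exists_log_deriv D.toJordanDomain Ψ
  set φ' : ConformalEquiv upperHalfPlaneSet D'.carrier := Φ.symm.trans (φ.restrHull D' hsub) with hφ'
  have hφ'u : D'.IsChordalUniformizing φ' :=
    MarkedDomain.IsChordalUniformizing.pullback JordanDomain.isSimplyConnected_holds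
      exists_conformalEquiv_ball_holds JordanDomain.exists_continuousOn_extension_holds hφ hD' hΦ
  obtain ⟨Ψ', hΨ'₀, hΨ'inf, hΨ'b, hΨ'real⟩ := exists_halfPlaneMap D' φ' hφ'u
  have hΨ' : ∀ z, Ψ' z = -(Φ (φ.symm z))⁻¹ := fun z => by rw [hΨ'₀ z]; rfl
  obtain ⟨L', hL'c, hL'e⟩ := exists_log_deriv D'.toJordanDomain Ψ'
  rw [hD'.pt_zero_eq, ← ha₀] at hΨ'inf hΨ'real
  rw [hD'.pt_one_eq, ← hb₀] at hΨ'b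
  rw [← ha₀] at hΨinf hΨreal
  rw [← hb₀] at hΨb
  -- radii: `D' = D` near `a₀` and `b₀`
  have hagree : ∀ p : ℂ, p ∉ closure (D.carrier \ D'.carrier) →
      ∃ r > 0, ∀ r' ≤ r, D'.carrier ∩ ball p r' = D.carrier ∩ ball p r' := by
    intro p hp
    obtain ⟨r, hr, hrs⟩ := Metric.mem_nhds_iff.1 (isClosed_closure.isOpen_compl.mem_nhds hp)
    refine ⟨r, hr, fun r' hr' => Set.ext fun z => ⟨fun h => ⟨hsub h.1, h.2⟩, fun h => ⟨?_, h.2⟩⟩⟩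
    by_contra h'
    exact hrs (ball_subset_ball hr' h.2) (subset_closure ⟨h.1, h'⟩)
  obtain ⟨ra, hra, hraD⟩ := hagree a₀ hD'.pt_zero_notMem
  obtain ⟨rb, hrb, hrbD⟩ := hagree b₀ hD'.pt_one_notMem
  set ρ₀ : ℝ := min (min ρ ra) (min rb (dist a₀ b₀)) / 2 with hρ₀
  have hρ₀pos : 0 < ρ₀ := by
    rw [hρ₀]; exact half_pos (lt_min (lt_min hρ hra) (lt_min hrb hdab))
  obtain ⟨hρ₀ρ, hρ₀a, hρ₀b, hρ₀d⟩ : 2 * ρ₀ ≤ ρ ∧ 2 * ρ₀ ≤ ra ∧ 2 * ρ₀ ≤ rb ∧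
      2 * ρ₀ ≤ dist a₀ b₀ := by
    rw [hρ₀]
    refine ⟨?_, ?_, ?_, ?_⟩ <;>
      linarith [min_le_left (min ρ ra) (min rb (dist a₀ b₀)), min_le_left ρ ra, min_le_right ρ ra,
        min_le_right (min ρ ra) (min rb (dist a₀ b₀)), min_le_left rb (dist a₀ b₀),
        min_le_right rb (dist a₀ b₀)]
  -- flatness of `D'` at `a₀` and `b₀` (radius `2ρ₀`)
  have hflat0' : D'.carrier ∩ ball a₀ (2 * ρ₀) = {z : ℂ | a₀.im < z.im} ∩ ball a₀ (2 * ρ₀) := by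
    rw [hraD _ hρ₀a]; exact flat_of_subset hflat0 (ball_subset_ball hρ₀ρ) rfl
  have hflat1' : D'.carrier ∩ ball b₀ (2 * ρ₀) = {z : ℂ | b₀.im < z.im} ∩ ball b₀ (2 * ρ₀) := by
    rw [hrbD _ hρ₀b]; exact flat_of_subset hflat1 (ball_subset_ball hρ₀ρ) rfl
  -- boundary limits at `b₀`
  have hne_b' : ∀ t : ℝ, |t| < ρ₀ → b₀ + (t : ℂ) ≠ a₀ := by
    intro t ht h
    have : dist a₀ b₀ = |t| := by
      rw [← h, dist_eq_norm, show b₀ + t - b₀ = (t : ℂ) by ring, norm_real, Real.norm_eq_abs]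
    linarith
  have hbvb : ∀ t : ℝ, |t| < ρ₀ → ∃ σ : ℝ, Tendsto Ψ (𝓝[D.carrier] (b₀ + t)) (𝓝 (σ : ℂ)) :=
    fun t ht => hΨreal _ (mem_frontier_of_flat hflat1 (by linarith)) (hne_b' t ht)
  have hbvb' : ∀ t : ℝ, |t| < ρ₀ → ∃ σ : ℝ, Tendsto Ψ' (𝓝[D'.carrier] (b₀ + t)) (𝓝 (σ : ℂ)) :=
    fun t ht => hΨ'real _ (mem_frontier_of_flat hflat1' (by linarith)) (hne_b' t ht)
  obtain ⟨Lb, hLb⟩ := exists_tendsto_log_deriv_of_flat Ψ hρ₀pos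
    (flat_of_subset hflat1 (ball_subset_ball (by linarith)) rfl) hbvb hLc hLe
  obtain ⟨L'b, hL'b⟩ := exists_tendsto_log_deriv_of_flat Ψ' hρ₀pos
    (flat_of_subset hflat1' (ball_subset_ball (by linarith)) rfl) hbvb' hL'c hL'e
  -- the key identity `exp (L' - L) = N ∘ φ⁻¹` on `D'`
  have hkey : ∀ z ∈ D'.carrier, exp (L' z - L z) =
      deriv (hullExt Φ) (φ.symm z) * (φ.symm z) ^ 2 / hullExt Φ (φ.symm z) ^ 2 := by
    intro z hz
    obtain ⟨hne, hder⟩ := deriv_halfPlaneMap_pullback hsub hB hΦ Ψ hΨ Ψ' hΨ' hz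
    rw [exp_sub, hL'e z hz, hLe z (hsub hz), hder, mul_div_assoc, div_self hne, mul_one]
  -- `exp (L'b - Lb) = 1`
  have hb1 : exp (L'b - Lb) = 1 := by
    refine exp_sub_eq_of_tendsto hsub (frontier_subset_closure ?_) hLb hL'b ?_ hkey
    · show D.pt 1 ∈ frontier D'.carrier
      rw [← hD'.pt_one_eq]; exact D'.pt_mem_frontier 1
    · have h1 : Tendsto φ.symm (𝓝[D'.carrier] b₀) (cocompact ℂ) :=
        hφ.tendsto_symm_cocompact.mono_left (nhdsWithin_mono _ hsub)
      exact (tendsto_derivRatio_cocompact hB hΦ).comp h1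
  -- the bulk ratio `M = (L' - L'b) - (L - Lb)`: `exp M = N ∘ φ⁻¹ → 1/d` at `a₀`
  set M : ℂ → ℂ := fun z => (L' z - L'b) - (L z - Lb) with hM
  have hMc : ContinuousOn M D'.carrier :=
    (hL'c.sub continuousOn_const).sub ((hLc.mono hsub).sub continuousOn_const)
  have hexpM : ∀ z ∈ D'.carrier, exp (M z) =
      deriv (hullExt Φ) (φ.symm z) * (φ.symm z) ^ 2 / hullExt Φ (φ.symm z) ^ 2 := by
    intro z hz
    have h1 : M z = (L' z - L z) - (L'b - Lb) := by rw [hM]; ring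
    rw [h1, exp_sub, hb1, div_one, hkey z hz]
  have h0 : Tendsto φ.symm (𝓝[D'.carrier] a₀) (𝓝[≠] 0) := by
    refine tendsto_nhdsWithin_iff.2 ⟨?_, ?_⟩
    · have := hφ.tendsto_symm_nhds_zero
      rw [← ha₀] at this
      exact this.mono_left (nhdsWithin_mono _ hsub)
    · filter_upwards [self_mem_nhdsWithin] with z hz
      intro h
      have : (0 : ℂ) ∈ upperHalfPlaneSet := by
        rw [← (h : φ.symm z = 0)]; exact φ.symm_mapsTo (hsub hz)
      exact absurd this (by simp [upperHalfPlaneSet])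
  have hexplim : Tendsto (fun z => exp (M z)) (𝓝[D'.carrier] a₀) (𝓝 ((d : ℂ)⁻¹)) := by
    refine ((tendsto_derivRatio_zero hA hΦ hd hd0).comp h0).congr' ?_
    filter_upwards [self_mem_nhdsWithin] with z hz
    exact (hexpM z hz).symm
  have hdC : (d : ℂ) ≠ 0 := by exact_mod_cast hd0.ne'
  obtain ⟨M₀, hM₀, hMlim⟩ := tendsto_log_of_tendsto_exp_of_flat (by linarith : (0 : ℝ) < 2 * ρ₀)
    hflat0' hMc (inv_ne_zero hdC) hexplim
  -- the number `q₀`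
  set q₀ : ℂ := exp ((5 / 8 : ℂ) * M₀) with hq₀
  have hq₀norm : ‖q₀‖ * d ^ ((5 : ℝ) / 8) = 1 := by
    have hre : M₀.re = -Real.log d := by
      have h1 : Real.exp M₀.re = d⁻¹ := by
        rw [← Complex.norm_exp, hM₀, norm_inv, norm_real, Real.norm_of_nonneg hd0.le]
      have h2 := congrArg Real.log h1
      rwa [Real.log_exp, Real.log_inv] at h2
    have h58 : ((5 / 8 : ℂ) * M₀).re = 5 / 8 * M₀.re := by
      rw [show (5 / 8 : ℂ) = ((5 / 8 : ℝ) : ℂ) by push_cast; ring, Complex.re_ofReal_mul]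
    rw [hq₀, Complex.norm_exp, h58, hre, Real.rpow_def_of_pos hd0, ← Real.exp_add]
    convert Real.exp_zero using 2
    ring
  have hqlim : Tendsto (fun z => exp ((5 / 8 : ℂ) * ((L' z - L'b) - (L z - Lb))))
      (𝓝[D'.carrier] a₀) (𝓝 q₀) := by
    have hc : Continuous fun m : ℂ => exp ((5 / 8 : ℂ) * m) := by fun_prop
    exact (hc.tendsto M₀).comp hMlim
  exact ⟨Ψ, L, Lb, Ψ', L', L'b, ρ₀, q₀, hρ₀pos, by linarith, hd0, hΨ, hΨinf, hΨb, hLc, hLe, hLb,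
    hΨ'inf, hΨ'b, hL'c, hL'e, hL'b,
    flat_of_subset hflat0' (ball_subset_ball (by linarith)) rfl,
    flat_of_subset hflat1' (ball_subset_ball (by linarith)) rfl, hq₀norm, hqlim⟩

/-- **Registered form `stub_avoidanceCocycle_package`** (crux item stmt-CriticalPhenomena-0808, line
`root-locality-replaces-loewner`, stub `stub_avoidanceCocycle`, step (b)): the conformal package with
the root datum (`exists_conformalPackageRoot`).
[cite: LawlerSchrammWerner2003Restriction, §2 (2.4) p. 7 and §2 p. 9, transposed] -/
theorem stub_avoidanceCocycle_package : ∀ (D D' : Literature.Probability.RandomPlanarGeometry.DobrushinDomain) (ρ : ℝ) (φ : Literature.Probability.RandomPlanarGeometry.ConformalEquiv UpperHalfPlane.upperHalfPlaneSet D.carrier) (Φ : Literature.Probability.RandomPlanarGeometry.ConformalEquiv (UpperHalfPlane.upperHalfPlaneSet \ φ.pullbackHull D') UpperHalfPlane.upperHalfPlaneSet) (d : ℝ), 0 < ρ → D.carrier ∩ Metric.ball (D.pt 0) ρ = {z : ℂ | (D.pt 0).im < z.im} ∩ Metric.ball (D.pt 0) ρ → D.carrier ∩ Metric.ball (D.pt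 1) ρ = {z : ℂ | (D.pt 1).im < z.im} ∩ Metric.ball (D.pt 1) ρ → D.IsHullSubdomain D' → D.IsChordalUniformizing φ → Literature.Probability.RandomPlanarGeometry.IsRestrictionMap (φ.pullbackHull D') Φ → Literature.Probability.RandomPlanarGeometry.HasRestrictionDeriv (φ.pullbackHull D') Φ d → ∃ (Ψ : Literature.Probability.RandomPlanarGeometry.ConformalEquiv D.carrier UpperHalfPlane.upperHalfPlaneSet) (L : ℂ → ℂ) (Lb : ℂ) (Ψ' : Literature.Probability.RandomPlanarGeometry.ConformalEquiv D'.carrier UpperHalfPlane.upperHalfPlaneSet) (L' : ℂ → ℂ) (L'b : ℂ) (ρ₁ : ℝ) (q₀ : ℂ), 0 < ρ₁ ∧ ρ₁ ≤ ρ ∧ 0 < d ∧ (∀ z, Ψ z = -(φ.symm z)⁻¹) ∧ Filter.Tendsto (fun z => ‖Ψ z‖) (nhdsWithin (D.pt 0) D.carrier) Filter.atTop ∧ Ψ.HasBoundaryValue (D.pt 1) 0 ∧ ContinuousOn L D.carrier ∧ (∀ z ∈ D.carrier, Complex.exp (L z) = deriv Ψ z) ∧ Filter.Tendsto L (nhdsWithin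 (D.pt 1) D.carrier) (nhds Lb) ∧ Filter.Tendsto (fun z => ‖Ψ' z‖) (nhdsWithin (D.pt 0) D'.carrier) Filter.atTop ∧ Ψ'.HasBoundaryValue (D.pt 1) 0 ∧ ContinuousOn L' D'.carrier ∧ (∀ z ∈ D'.carrier, Complex.exp (L' z) = deriv Ψ' z) ∧ Filter.Tendsto L' (nhdsWithin (D.pt 1) D'.carrier) (nhds L'b) ∧ D'.carrier ∩ Metric.ball (D.pt 0) ρ₁ = {z : ℂ | (D.pt 0).im < z.im} ∩ Metric.ball (D.pt 0) ρ₁ ∧ D'.carrier ∩ Metric.ball (D.pt 1) ρ₁ = {z : ℂ | (D.pt 1).im < z.im} ∩ Metric.ball (D.pt 1) ρ₁ ∧ ‖q₀‖ * d ^ ((5 : ℝ) / 8) = 1 ∧ Filter.Tendsto (fun z => Complex.exp ((5 / 8 : ℂ) * ((L' z - L'b) - (L z - Lb)))) (nhdsWithin (D.pt 0) D'.carrier) (nhds q₀) :=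
  fun D D' ρ φ Φ d hρ hflat0 hflat1 hD' hφ hΦ hd =>
    exists_conformalPackageRoot D D' ρ φ Φ d hρ hflat0 hflat1 hD' hφ hΦ hd

end Summit.CriticalPhenomena.SAWScalingLimit.Theorems.HexConjecture.RootLocality.Cocycle

end
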